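import Summits.QuantumFields.BalabanUV.T4Continuum.Support.NE3EnergyPathC2
import Summits.QuantumFields.BalabanUV.T4Continuum.Support.NE3HessContinuity
import Summits.QuantumFields.BalabanUV.T4Continuum.Support.NE3HessShapes
import Summits.QuantumFields.BalabanUV.T4Continuum.Support.NE3EnergyResidual
import Summits.QuantumFields.BalabanUV.T4Continuum.Support.AveragingDeficitPlaqDeriv

/-!
# T⁴ programme, node NE3, route P2 «ENERGY CONVEXITY» — leaf L11 «MIX» (typer sub-row S5-Y11): the MIXED second
# variation of the Wilson action along a general path with an INDEPENDENT inserted field, the datum-segment mean-value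
# bound in the energy norm (the kernel half of `dDiff_le_of_mix`; the SHAPE `HBound` lives in `NE3EnergyMixShape`)

NE3 formalisation swarm, leaf seat `b2b-balaban-t4-ne3-formalise-leaf-05` (gen 3), sub-row S5-Y11 of
`HOME/t4/formal/NE3/LEAVES.md` = leaf L11 «MIX (T-LIP only) — THE CONSTRAINT DATUM ENTERS THROUGH H_W» of road P2's
skeleton `HOME/t4/skeletons/NE3-t4-ne3-p2.md` §2A (typer names `HBound`, `dDiff_le_of_mix`).
WHY.  The two-data root T-LIP (`Support/NE3EnergyLipschitz.EnergyLipschitz`, p213741) is assembled from the hypothesis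
structure `LipLeaves`, whose field `mix : φ₁′ 1 − D₂ ≤ ΛH·√(dirSq (B₁ − B₂) (periodBox N))·energyNorm W X (periodBox (N·L^k))`
compares the first variations of the TWO fibre functionals (data `B₁`, `B₂`) at the common end of the two admissible
paths.  In the route's dictionary the two end configurations are joined by the DATUM SEGMENT `s ↦ W^σ_s := W·exp σ(s)`,
`σ(s) = Φ_W(a(1) + H_W(B₂ + s(B₁ − B₂)))` (B11's translation `A′ = A₁ + H_W B`, (101)–(102) p. 293, context only), and
`φ₁′ 1 − D₂ = ψ(1) − ψ(0)` for `ψ(s) := dAction W^σ_s (Y s)`, `Y s` the right-logarithmic `t`-velocity of the `s`-th path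
at `t = 1`.  The mean-value step needs `ψ′(s)`: the MIXED second variation along a general path against an inserted
field that is NOT the path's own velocity (the tree's `NE3EnergyPathC2.hasDerivAt_dAction_gpath`, leaf L3, is the
diagonal case).  THIS FILE supplies ([folklore] matrix calculus and real analysis; every analytic input BY NAME; 0 `def`):
§1 `hasDerivAt_curlAt_gpath₂` ∕ `hasDerivAt_dwtAt_gpath₂` ∕ `hasDerivAt_dwt_gpath₂` ∕ **`hasDerivAt_dAction_gpath₂`**: along
   `W_t := vary W (Γ t) 1` with right-logarithmic velocity `Ψ` at `t₀` and an independent moving inserted field `Y t`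
   (bondwise derivative `Y′` at `t₀`): `d/dt dAction W_t (Y t) Wn = hess W_{t₀} Ψ (Y t₀) Wn + dAction W_{t₀} Y′ Wn`;
   `hasDerivAt_dAction_gpath_const` (constant `Y`: `hess W_{t₀} Ψ Y Wn` alone — the `h′(t) = Hess(γ t)[X, Y]` of road P3);
§2 `abs_hess_perWin_le_dirSq` ∕ `abs_hess_perWin_le_energyNorm`: the MIXED (non-symmetrised) Hessian on the period
   window against periodic directions, `|hess V X Y (perWin d M)| ≤ 48·d·N(X)·N(Y)` in the `√dirSq` currency and a
   fortiori in road P2's `energyNorm` at ANY backgrounds (P3's `NE3HessContinuity.abs_hess_le` + `NE3HessShapes.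
   sum_plaqsOf_bondSq_le` + `NE3EnergyResidual.sqrt_dirSq_le_energyNorm` BY NAME; the `hessSym` version is S5-Y8a's);
§3 `abs_sub_le_of_abs_deriv_le`: the mean-value step on `[0,1]` (Mathlib `norm_image_sub_le_of_norm_deriv_le_segment_01'`);
§4 **`abs_dAction_sub_dAction_le`** (+ `…_le_energy`): unitary `W`, skew datum path `σ` with periodic right-logarithmic
   velocities `Z s`, periodic inserted fields `Y s` with derivatives `Y′ s`:
   `|dAction W^σ_1 (Y 1) (perWin d M) − dAction W^σ_0 (Y 0) (perWin d M)| ≤ 48·d·ζ·υ + α` whenever on `[0,1]`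
   `√dirSq (Z s) ≤ ζ`, `√dirSq (Y s) ≤ υ`, `|dAction W^σ_s (Y′ s) (perWin d M)| ≤ α`;
§5∕§6 (companion file `Support/NE3EnergyMixShape`): the hypothesis SHAPE `HBound W N P H CH` (typer `HBound`, B9
   (3.133) ∕ B11 (46) TYPE as context only) and **`dDiff_le_of_mix`** = the inequality of `LipLeaves.mix` in its literal
   shape with `ΛH := 48·d·(1+θ₁)·(1+θ₂)·CH + κH` from `HBound` + three one-configuration chart-distortion binders.
Every binder concerns ONE configuration family on ONE lattice (no minimiser, no two spacings, no rate): the row's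
disguise test passes.  The instantiation on Bałaban's chart (`σ, Z, Y, Y′` from `Φ_W`, `H_W` and the two-parameter
family `(t,s) ↦ Φ_W(a(t) + H_W B_s)`) is the torus instance S5-Y8b ∕ the single writers' business, as for leaf L3.

HONEST FRAMING.  Finite-T⁴ ultraviolet bookkeeping (rung (B)+1: existence and uniqueness of the ε → 0 limit of
gauge-invariant observables on a FIXED finite torus); kernel calculus + a typed hypothesis shape; NOTHING about Bałaban's
minimisers, `Φ_W` or `H_W` is asserted; «T-LIP CONDITIONAL on ⟨named structures⟩» unchanged; NE3 NOT proved; spine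
PROVED 0∕9; NO coercivity (leaf L5, typer ρ19) stated or consumed; no conditional of the cell (`BetaPertH`, (B),
G-an2-4) used or hidden; NOT infinite volume, NOT a mass gap, NOT Clay, NOT summit progress.  ABSOLUTE RULE kept: no
printed sentence is a hypothesis (context only: [Balaban1985Variational] (45)–(46) p. 285, (101)–(102) p. 293, §E
pp. 295–296; B9 (3.133) p. 422).  PLACEMENT: our lemmas under `Summits/QuantumFields/BalabanUV/`; imports the accepted
`Support.NE3EnergyPathC2` (p213685), `Support.NE3HessContinuity` (p213887), `Support.NE3HessShapes` (p214187),
`Support.NE3EnergyResidual` (p213350), `Support.AveragingDeficitPlaqDeriv` BY NAME; restates nothing; NO `def`.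
-/

set_option autoImplicit false

open scoped BigOperators Matrix.Norms.L2Operator
open NormedSpace Finset

namespace Summit.QuantumFields.BalabanUV.T4Continuum.NE3EnergyMix

open Set
open Literature.MathematicalPhysics.QuantumFieldTheory.Balaban1983to89
open B7Prop1Explicit B7Prop2Explicit MatrixLog UnitaryModel
open T4AveragingDeficitWall hiding Site Plane Plaq Bond
open T4AveragingDeficitWallBoundary (periodBox)
open AveragingDeficitPeriodicCounting (IsPeriodicDir)
open AveragingDeficitTransport (dhol dhol_plaqWord)
open AveragingDeficitPlaqDeriv (vary_isUnitaryCfg)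
open MinimalActionLevels (perWin)
open NE3HessForm (dcurlAt dAction hessPlaqAt hessPlaq hess)
open NE3HessBounds (bondSq bondSqAt)
open NE3HessContinuity (abs_hess_le)
open NE3HessShapes (plaqsOf sum_plaqsOf_bondSq_le)
open NE3EnergyShapes (energyNorm energyNorm_nonneg)
open NE3EnergyResidual (sqrt_dirSq_le_energyNorm)
open NE3EnergyPathC2 (hasDerivAt_Ad_gpath₁ hasDerivAt_Ad_gpath₂ hasDerivAt_Ad_gpath₃ hasDerivAt_val_hol_gpath)

noncomputable section

variable {d : ℕ} {n : Type*} [Fintype n] [DecidableEq n]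

/-! ## §1 The mixed second variation along a general path with an independent inserted field -/

/-- **THE DRESSED CURL OF A MOVING FIELD ALONG A GENERAL PATH**: along `W_t := W·exp Γ(t)` (tree `vary W (Γ t) 1`)
with bondwise right-logarithmic velocity `Ψ` at `t₀` (`hE`) and an INDEPENDENT inserted field `Y t` with bondwise
derivative `Y′` at `t₀` (`hY`):
`d/dt (d_{W_t} Y_t)(z; μ < ν) = dcurlAt W_{t₀} Ψ (Y t₀) z μ ν + (d_{W_{t₀}} Y′)(z; μ < ν)` at `t₀`
(the tree's `NE3EnergyPathC2.hasDerivAt_curlAt_gpath` is the diagonal case `Y = Ψ`). [folklore] -/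
theorem hasDerivAt_curlAt_gpath₂ (W : Site d → Fin d → (Matrix n n ℂ)ˣ)
    {Γ : ℝ → Site d → Fin d → Matrix n n ℂ} {Ψ : Site d → Fin d → Matrix n n ℂ}
    {Y : ℝ → Site d → Fin d → Matrix n n ℂ} {Y' : Site d → Fin d → Matrix n n ℂ} {t₀ : ℝ}
    (hE : ∀ y κ, HasDerivAt (fun t => exp (Γ t y κ)) (exp (Γ t₀ y κ) * Ψ y κ) t₀)
    (hY : ∀ y κ, HasDerivAt (fun t => Y t y κ) (Y' y κ) t₀) (z : Site d) (μ ν : Fin d) :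
    HasDerivAt (fun t : ℝ => curlAt (vary W (Γ t) 1) (Y t) z μ ν)
      (dcurlAt (vary W (Γ t₀) 1) Ψ (Y t₀) z μ ν + curlAt (vary W (Γ t₀) 1) Y' z μ ν) t₀ := by
  have g₁ := hasDerivAt_Ad_gpath₁ (W z μ) (hE z μ) (hY z μ)
  have g₂ := hasDerivAt_Ad_gpath₂ (W z μ) (W (z + e μ) ν) (hE z μ) (hE (z + e μ) ν) (hY (z + e μ) ν)
  have g₃ := hasDerivAt_Ad_gpath₂ (W z μ) (W (z + e μ) ν) (hE z μ) (hE (z + e μ) ν) (hY (z + e ν) μ)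
  have g₄ := hasDerivAt_Ad_gpath₃ (W z μ) (W (z + e μ) ν) (W (z + e ν) μ) (hE z μ) (hE (z + e μ) ν)
    (hE (z + e ν) μ) (hY z ν)
  have H := ((g₁.add g₂).sub g₃).sub g₄
  refine (H.congr_of_eventuallyEq (Filter.Eventually.of_forall fun t => ?_)).congr_deriv ?_
  · simp only [Pi.add_apply, Pi.sub_apply, curlAt, vary, Complex.ofReal_one, one_smul]
  · simp only [dcurlAt, curlAt, vary, Complex.ofReal_one, one_smul]
    abel

/-- One plaquette: `d/dt (−Re tr[(d_{W_t} Y_t)(p′)·W_t(∂p′)]) = hessPlaqAt W_{t₀} Ψ (Y t₀) p′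
− Re tr[(d_{W_{t₀}} Y′)(p′)·W_{t₀}(∂p′)]` at `t₀`. [folklore] -/
theorem hasDerivAt_dwtAt_gpath₂ (W : Site d → Fin d → (Matrix n n ℂ)ˣ)
    {Γ : ℝ → Site d → Fin d → Matrix n n ℂ} {Ψ : Site d → Fin d → Matrix n n ℂ}
    {Y : ℝ → Site d → Fin d → Matrix n n ℂ} {Y' : Site d → Fin d → Matrix n n ℂ} {t₀ : ℝ}
    (hE : ∀ y κ, HasDerivAt (fun t => exp (Γ t y κ)) (exp (Γ t₀ y κ) * Ψ y κ) t₀)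
    (hY : ∀ y κ, HasDerivAt (fun t => Y t y κ) (Y' y κ) t₀) (z : Site d) (μ ν : Fin d) :
    HasDerivAt (fun t : ℝ => -nReTr (curlAt (vary W (Γ t) 1) (Y t) z μ ν
        * ((hol (vary W (Γ t) 1) z (plaqWord μ ν) : (Matrix n n ℂ)ˣ) : Matrix n n ℂ)))
      (hessPlaqAt (vary W (Γ t₀) 1) Ψ (Y t₀) z μ ν
        + -nReTr (curlAt (vary W (Γ t₀) 1) Y' z μ ν
            * ((hol (vary W (Γ t₀) 1) z (plaqWord μ ν) : (Matrix n n ℂ)ˣ) : Matrix n n ℂ))) t₀ := by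
  have hc := hasDerivAt_curlAt_gpath₂ W hE hY z μ ν
  have hh := hasDerivAt_val_hol_gpath W hE (plaqWord μ ν) z
  rw [dhol_plaqWord] at hh
  have h := hc.mul hh
  have h2 := ((nReTrL (n := n)).hasFDerivAt.comp_hasDerivAt t₀ h).neg
  refine (h2.congr_of_eventuallyEq (Filter.Eventually.of_forall fun t => ?_)).congr_deriv ?_
  · simp only [Pi.neg_apply, Function.comp_apply, Pi.mul_apply, nReTrL_apply]
  · simp only [hessPlaqAt, ← nReTrL_apply, add_mul, mul_assoc, map_add, neg_add]
    abel

/-- Indexed plaquettes: `d/dt (−Re tr[(d_{W_t} Y_t)(p)·W_t(∂p)]) = hessPlaq W_{t₀} Ψ (Y t₀) p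
− Re tr[(d_{W_{t₀}} Y′)(p)·W_{t₀}(∂p)]`. [folklore] -/
theorem hasDerivAt_dwt_gpath₂ (W : Site d → Fin d → (Matrix n n ℂ)ˣ)
    {Γ : ℝ → Site d → Fin d → Matrix n n ℂ} {Ψ : Site d → Fin d → Matrix n n ℂ}
    {Y : ℝ → Site d → Fin d → Matrix n n ℂ} {Y' : Site d → Fin d → Matrix n n ℂ} {t₀ : ℝ}
    (hE : ∀ y κ, HasDerivAt (fun t => exp (Γ t y κ)) (exp (Γ t₀ y κ) * Ψ y κ) t₀)
    (hY : ∀ y κ, HasDerivAt (fun t => Y t y κ) (Y' y κ) t₀) (p : T4AveragingDeficitWall.Plaq d) :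
    HasDerivAt (fun t : ℝ => -nReTr (curl (vary W (Γ t) 1) (Y t) p
        * ((fhol (vary W (Γ t) 1) p : (Matrix n n ℂ)ˣ) : Matrix n n ℂ)))
      (hessPlaq (vary W (Γ t₀) 1) Ψ (Y t₀) p
        + -nReTr (curl (vary W (Γ t₀) 1) Y' p * ((fhol (vary W (Γ t₀) 1) p : (Matrix n n ℂ)ˣ) : Matrix n n ℂ))) t₀ :=
  hasDerivAt_dwtAt_gpath₂ W hE hY p.1 p.2.1.1 p.2.1.2

/-- **THE MIXED SECOND VARIATION ALONG A GENERAL PATH**: with `W_t := vary W (Γ t) 1`, right-logarithmic velocity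
`Ψ` at `t₀` and an independent inserted field `Y t` with bondwise derivative `Y′` at `t₀`, for every finite window `Wn`:
`d/dt dAction W_t (Y t) Wn = hess W_{t₀} Ψ (Y t₀) Wn + dAction W_{t₀} Y′ Wn` at `t₀`
(diagonal case `Y = Ψ`: the tree's `NE3EnergyPathC2.hasDerivAt_dAction_gpath`; straight segment with constant `Y`:
`NE3HessForm.hasDerivAt_dAction_vary_at₂`). [folklore] -/
theorem hasDerivAt_dAction_gpath₂ (W : Site d → Fin d → (Matrix n n ℂ)ˣ)
    {Γ : ℝ → Site d → Fin d → Matrix n n ℂ} {Ψ : Site d → Fin d → Matrix n n ℂ}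
    {Y : ℝ → Site d → Fin d → Matrix n n ℂ} {Y' : Site d → Fin d → Matrix n n ℂ} {t₀ : ℝ}
    (hE : ∀ y κ, HasDerivAt (fun t => exp (Γ t y κ)) (exp (Γ t₀ y κ) * Ψ y κ) t₀)
    (hY : ∀ y κ, HasDerivAt (fun t => Y t y κ) (Y' y κ) t₀) (Wn : Finset (T4AveragingDeficitWall.Plaq d)) :
    HasDerivAt (fun t : ℝ => dAction (vary W (Γ t) 1) (Y t) Wn)
      (hess (vary W (Γ t₀) 1) Ψ (Y t₀) Wn + dAction (vary W (Γ t₀) 1) Y' Wn) t₀ := by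
  have h := HasDerivAt.sum (u := Wn) (x := t₀)
    (A := fun p t => -nReTr (curl (vary W (Γ t) 1) (Y t) p
      * ((fhol (vary W (Γ t) 1) p : (Matrix n n ℂ)ˣ) : Matrix n n ℂ)))
    (A' := fun p => hessPlaq (vary W (Γ t₀) 1) Ψ (Y t₀) p
      + -nReTr (curl (vary W (Γ t₀) 1) Y' p * ((fhol (vary W (Γ t₀) 1) p : (Matrix n n ℂ)ˣ) : Matrix n n ℂ)))
    fun p _ => hasDerivAt_dwt_gpath₂ W hE hY p
  have h' : HasDerivAt (fun t : ℝ => ∑ p ∈ Wn, -nReTr (curl (vary W (Γ t) 1) (Y t) p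
        * ((fhol (vary W (Γ t) 1) p : (Matrix n n ℂ)ˣ) : Matrix n n ℂ)))
      (∑ p ∈ Wn, (hessPlaq (vary W (Γ t₀) 1) Ψ (Y t₀) p
        + -nReTr (curl (vary W (Γ t₀) 1) Y' p * ((fhol (vary W (Γ t₀) 1) p : (Matrix n n ℂ)ˣ) : Matrix n n ℂ)))) t₀ := by
    simpa [Finset.sum_fn] using h
  refine (h'.congr_of_eventuallyEq (Filter.Eventually.of_forall fun t => ?_)).congr_deriv ?_
  · simp only [dAction, Finset.sum_neg_distrib]
  · simp only [hess, dAction, Finset.sum_add_distrib, Finset.sum_neg_distrib]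

/-- A CONSTANT inserted field `Y`: `d/dt dAction W_t Y Wn = hess W_{t₀} Ψ Y Wn` at `t₀` — the `h′(t) = Hess(γ t)[X, Y]`
of road P3's local step, in right-logarithmic velocity form (no ordering correction). [folklore] -/
theorem hasDerivAt_dAction_gpath_const (W : Site d → Fin d → (Matrix n n ℂ)ˣ)
    {Γ : ℝ → Site d → Fin d → Matrix n n ℂ} {Ψ : Site d → Fin d → Matrix n n ℂ} {t₀ : ℝ}
    (hE : ∀ y κ, HasDerivAt (fun t => exp (Γ t y κ)) (exp (Γ t₀ y κ) * Ψ y κ) t₀)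
    (Y : Site d → Fin d → Matrix n n ℂ) (Wn : Finset (T4AveragingDeficitWall.Plaq d)) :
    HasDerivAt (fun t : ℝ => dAction (vary W (Γ t) 1) Y Wn) (hess (vary W (Γ t₀) 1) Ψ Y Wn) t₀ := by
  have h := hasDerivAt_dAction_gpath₂ W (Y := fun _ => Y) (Y' := fun _ _ => 0) hE
    (fun y κ => hasDerivAt_const t₀ (Y y κ)) Wn
  have h0 : dAction (vary W (Γ t₀) 1) (fun _ _ => (0 : Matrix n n ℂ)) Wn = 0 := by
    simp [dAction, curl, T4AveragingDeficitWall.curlAt, Ad, nReTr]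
  simpa [h0] using h

/-! ## §2 The mixed Hessian on the period window against periodic directions, in the energy currency -/

/-- **`|hess V X Y (perWin d M)| ≤ 48·d·√(dirSq X (periodBox M))·√(dirSq Y (periodBox M))`** for unitary `V`, `1 ≤ M`
and `(M:ℤ)`-periodic `X, Y` (P3's `abs_hess_le`, Λ = 12 in the bond-ℓ² currency, and the torus bond multiplicity
`Σ_{p ∈ plaqsOf (periodBox M)} bondSq ≤ 4d·dirSq`; `perWin d M` IS `plaqsOf (periodBox M)`). [folklore] -/
theorem abs_hess_perWin_le_dirSq [Nonempty n] {V : Site d → Fin d → (Matrix n n ℂ)ˣ} (hV : IsUnitaryCfg V)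
    {M : ℕ} (hM : 1 ≤ M) {X Y : Site d → Fin d → Matrix n n ℂ} (hX : IsPeriodicDir X M) (hY : IsPeriodicDir Y M) :
    |hess V X Y (perWin d M)| ≤ 48 * d * (Real.sqrt (dirSq X (periodBox M)) * Real.sqrt (dirSq Y (periodBox M))) := by
  have h : |hess V X Y (plaqsOf (periodBox M))|
      ≤ 12 * (Real.sqrt (∑ p ∈ plaqsOf (periodBox M), bondSq X p) * Real.sqrt (∑ p ∈ plaqsOf (periodBox M), bondSq Y p)) :=
    abs_hess_le hV X Y _
  have h4d : (0 : ℝ) ≤ 4 * (d : ℝ) := by positivity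
  have hbX := sum_plaqsOf_bondSq_le (n := n) hM hX
  have hbY := sum_plaqsOf_bondSq_le (n := n) hM hY
  set a := Real.sqrt (∑ p ∈ plaqsOf (periodBox M), bondSq X p) with ha
  set b := Real.sqrt (∑ p ∈ plaqsOf (periodBox M), bondSq Y p) with hb
  set x := Real.sqrt (dirSq X (periodBox M)) with hx
  set y := Real.sqrt (dirSq Y (periodBox M)) with hy
  have hb0 : 0 ≤ b := Real.sqrt_nonneg _
  have hx0 : 0 ≤ x := Real.sqrt_nonneg _
  have hs0 : 0 ≤ Real.sqrt (4 * (d : ℝ)) := Real.sqrt_nonneg _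
  have hX' : a ≤ Real.sqrt (4 * (d : ℝ)) * x := by
    rw [ha, hx, ← Real.sqrt_mul h4d]
    exact Real.sqrt_le_sqrt hbX
  have hY' : b ≤ Real.sqrt (4 * (d : ℝ)) * y := by
    rw [hb, hy, ← Real.sqrt_mul h4d]
    exact Real.sqrt_le_sqrt hbY
  have hs : Real.sqrt (4 * (d : ℝ)) * Real.sqrt (4 * (d : ℝ)) = 4 * d := Real.mul_self_sqrt h4d
  have hab : a * b ≤ 4 * d * (x * y) := by
    calc a * b ≤ (Real.sqrt (4 * (d : ℝ)) * x) * (Real.sqrt (4 * (d : ℝ)) * y) :=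
          mul_le_mul hX' hY' hb0 (mul_nonneg hs0 hx0)
      _ = (Real.sqrt (4 * (d : ℝ)) * Real.sqrt (4 * (d : ℝ))) * (x * y) := by ring
      _ = 4 * d * (x * y) := by rw [hs]
  show |hess V X Y (plaqsOf (periodBox M))| ≤ 48 * d * (x * y)
  linarith

/-- **IN THE ENERGY NORM, ANY BACKGROUNDS**: for unitary `V`, backgrounds `W₁, W₂`, `1 ≤ M` and `(M:ℤ)`-periodic `X, Y`:
`|hess V X Y (perWin d M)| ≤ 48·d·energyNorm W₁ X (periodBox M)·energyNorm W₂ Y (periodBox M)` (only the `dirSq`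
part of road P2's energy norm is used; k-uniform). [folklore] -/
theorem abs_hess_perWin_le_energyNorm [Nonempty n] {V : Site d → Fin d → (Matrix n n ℂ)ˣ} (hV : IsUnitaryCfg V)
    (W₁ W₂ : Site d → Fin d → (Matrix n n ℂ)ˣ) {M : ℕ} (hM : 1 ≤ M) {X Y : Site d → Fin d → Matrix n n ℂ}
    (hX : IsPeriodicDir X M) (hY : IsPeriodicDir Y M) :
    |hess V X Y (perWin d M)| ≤ 48 * d * (energyNorm W₁ X (periodBox M) * energyNorm W₂ Y (periodBox M)) := by
  have h := abs_hess_perWin_le_dirSq hV hM hX hY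
  have hprod : Real.sqrt (dirSq X (periodBox M)) * Real.sqrt (dirSq Y (periodBox M))
      ≤ energyNorm W₁ X (periodBox M) * energyNorm W₂ Y (periodBox M) :=
    mul_le_mul (sqrt_dirSq_le_energyNorm W₁ X _) (sqrt_dirSq_le_energyNorm W₂ Y _) (Real.sqrt_nonneg _)
      (energyNorm_nonneg _ _ _)
  have hd : (0 : ℝ) ≤ 48 * (d : ℝ) := by positivity
  exact h.trans (mul_le_mul_of_nonneg_left hprod hd)

/-! ## §3 The one-variable mean-value step -/

/-- If `ψ` is differentiable on `[0,1]` with `|ψ′| ≤ C` there, then `|ψ 1 − ψ 0| ≤ C` (Mathlib's mean-value inequality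
on the unit segment). [folklore] -/
theorem abs_sub_le_of_abs_deriv_le {ψ ψ' : ℝ → ℝ} {C : ℝ} (hψ : ∀ s ∈ Icc (0:ℝ) 1, HasDerivAt ψ (ψ' s) s)
    (hb : ∀ s ∈ Icc (0:ℝ) 1, |ψ' s| ≤ C) : |ψ 1 - ψ 0| ≤ C := by
  have h := norm_image_sub_le_of_norm_deriv_le_segment_01' (f := ψ) (f' := ψ')
    (fun s hs => (hψ s hs).hasDerivWithinAt)
    (fun s hs => by simpa only [Real.norm_eq_abs] using hb s (Ico_subset_Icc_self hs))
  simpa only [Real.norm_eq_abs] using h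

/-! ## §4 The datum-segment bound: first variations at the two ends of a path differ by (mixed Hessian) + (acceleration) -/

/-- **FIRST VARIATIONS AT THE TWO ENDS OF A DATUM PATH.**  Let `W` be unitary, `σ : ℝ → directions` a path of SKEW
fields on `[0,1]` (so every `W^σ_s := vary W (σ s) 1` is unitary) with bondwise right-logarithmic velocity `Z s`
(`hE`), and `Y s` an inserted field with bondwise derivative `Y′ s` (`hYd`), `s ∈ [0,1]`; let `1 ≤ M` and `Z s`, `Y s`
be `(M:ℤ)`-periodic on `[0,1]`.  If on `[0,1]` `√(dirSq (Z s) (periodBox M)) ≤ ζ`, `√(dirSq (Y s) (periodBox M)) ≤ υ` and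
`|dAction W^σ_s (Y′ s) (perWin d M)| ≤ α`, then
`|dAction W^σ_1 (Y 1) (perWin d M) − dAction W^σ_0 (Y 0) (perWin d M)| ≤ 48·d·ζ·υ + α`. [folklore] -/
theorem abs_dAction_sub_dAction_le [Nonempty n] {W : Site d → Fin d → (Matrix n n ℂ)ˣ} (hW : IsUnitaryCfg W)
    {σ Z Y Y' : ℝ → Site d → Fin d → Matrix n n ℂ} (hσ : ∀ s ∈ Icc (0:ℝ) 1, IsSkewDir (σ s))
    (hE : ∀ s ∈ Icc (0:ℝ) 1, ∀ y κ, HasDerivAt (fun r => exp (σ r y κ)) (exp (σ s y κ) * Z s y κ) s)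
    (hYd : ∀ s ∈ Icc (0:ℝ) 1, ∀ y κ, HasDerivAt (fun r => Y r y κ) (Y' s y κ) s)
    {M : ℕ} (hM : 1 ≤ M) (hZp : ∀ s ∈ Icc (0:ℝ) 1, IsPeriodicDir (Z s) M)
    (hYp : ∀ s ∈ Icc (0:ℝ) 1, IsPeriodicDir (Y s) M) {ζ υ α : ℝ}
    (hζ : ∀ s ∈ Icc (0:ℝ) 1, Real.sqrt (dirSq (Z s) (periodBox M)) ≤ ζ)
    (hυ : ∀ s ∈ Icc (0:ℝ) 1, Real.sqrt (dirSq (Y s) (periodBox M)) ≤ υ)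
    (hα : ∀ s ∈ Icc (0:ℝ) 1, |dAction (vary W (σ s) 1) (Y' s) (perWin d M)| ≤ α) :
    |dAction (vary W (σ 1) 1) (Y 1) (perWin d M) - dAction (vary W (σ 0) 1) (Y 0) (perWin d M)|
      ≤ 48 * d * (ζ * υ) + α := by
  refine abs_sub_le_of_abs_deriv_le (ψ := fun s => dAction (vary W (σ s) 1) (Y s) (perWin d M))
    (ψ' := fun s => hess (vary W (σ s) 1) (Z s) (Y s) (perWin d M) + dAction (vary W (σ s) 1) (Y' s) (perWin d M))
    (fun s hs => hasDerivAt_dAction_gpath₂ W (hE s hs) (hYd s hs) (perWin d M)) (fun s hs => ?_)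
  have hU : IsUnitaryCfg (vary W (σ s) 1) := vary_isUnitaryCfg hW (hσ s hs) 1
  have h1 := abs_hess_perWin_le_dirSq hU hM (hZp s hs) (hYp s hs)
  have hζ0 : 0 ≤ ζ := (Real.sqrt_nonneg _).trans (hζ s hs)
  have hprod : Real.sqrt (dirSq (Z s) (periodBox M)) * Real.sqrt (dirSq (Y s) (periodBox M)) ≤ ζ * υ :=
    mul_le_mul (hζ s hs) (hυ s hs) (Real.sqrt_nonneg _) hζ0
  have hd : (0 : ℝ) ≤ 48 * (d : ℝ) := by positivity
  have h2 : |hess (vary W (σ s) 1) (Z s) (Y s) (perWin d M)| ≤ 48 * d * (ζ * υ) :=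
    h1.trans (mul_le_mul_of_nonneg_left hprod hd)
  exact (abs_add_le _ _).trans (add_le_add h2 (hα s hs))

/-- The same with the smallness read in road P2's ENERGY NORM at arbitrary backgrounds `W₁` (for the datum velocities)
and `W₂` (for the inserted fields). [folklore] -/
theorem abs_dAction_sub_dAction_le_energy [Nonempty n] {W : Site d → Fin d → (Matrix n n ℂ)ˣ} (hW : IsUnitaryCfg W)
    {σ Z Y Y' : ℝ → Site d → Fin d → Matrix n n ℂ} (hσ : ∀ s ∈ Icc (0:ℝ) 1, IsSkewDir (σ s))
    (hE : ∀ s ∈ Icc (0:ℝ) 1, ∀ y κ, HasDerivAt (fun r => exp (σ r y κ)) (exp (σ s y κ) * Z s y κ) s)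
    (hYd : ∀ s ∈ Icc (0:ℝ) 1, ∀ y κ, HasDerivAt (fun r => Y r y κ) (Y' s y κ) s)
    {M : ℕ} (hM : 1 ≤ M) (hZp : ∀ s ∈ Icc (0:ℝ) 1, IsPeriodicDir (Z s) M)
    (hYp : ∀ s ∈ Icc (0:ℝ) 1, IsPeriodicDir (Y s) M) (W₁ W₂ : Site d → Fin d → (Matrix n n ℂ)ˣ) {ζ υ α : ℝ}
    (hζ : ∀ s ∈ Icc (0:ℝ) 1, energyNorm W₁ (Z s) (periodBox M) ≤ ζ)
    (hυ : ∀ s ∈ Icc (0:ℝ) 1, energyNorm W₂ (Y s) (periodBox M) ≤ υ)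
    (hα : ∀ s ∈ Icc (0:ℝ) 1, |dAction (vary W (σ s) 1) (Y' s) (perWin d M)| ≤ α) :
    |dAction (vary W (σ 1) 1) (Y 1) (perWin d M) - dAction (vary W (σ 0) 1) (Y 0) (perWin d M)|
      ≤ 48 * d * (ζ * υ) + α :=
  abs_dAction_sub_dAction_le hW hσ hE hYd hM hZp hYp
    (fun s hs => (sqrt_dirSq_le_energyNorm W₁ (Z s) _).trans (hζ s hs))
    (fun s hs => (sqrt_dirSq_le_energyNorm W₂ (Y s) _).trans (hυ s hs)) hα

end

end Summit.QuantumFields.BalabanUV.T4Continuum.NE3EnergyMix
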